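import Literature.AlgebraicGeometry.ModuliOfAbelianVarieties.SiegelCMLatticeReciprocity
import HarnessLib

/-!
# The CM lattice dictionary of a special pair: the lattice of `[J, r·a]` is `t₀ ·` (the completed lattice of `[J, a]`) read in `F`
# ([Deligne 1971] 4.18–4.20; [Milne 2005] §4, Def. 12.8 (60)–(62), §14 Cor. 14.11; [Shimura 1998] §18.6 «`g(s)⁻¹𝔞`»)

Topic `AlgebraicGeometry/ModuliOfAbelianVarieties`; namespace `Literature.AlgebraicGeometry.ModuliOfAbelianVarieties.CMStructure`.
Cell hodgecm-mathlib (D-0151), fan B, layer (σ4)-D of the Siegel canonical model; a banked GENERIC leaf toward row I-7 (#60)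
`SiegelS1` (director s86 (2)(b); #60 road, MUMFORD-LINE-SPEC §3 STEP 5 «`ℚ^{2g} ∩ (r(s)a)·ẑ^{2g} = N_Φ(s)·L_a` as `F`-lattices»
= field (S-a) of the next-shift moduli reading T1′, B-p09's R60-34 census), in the GENERAL-LATTICE / CYCLIC-VECTOR currency —
the complement of ★ R60-35 `SiegelCMLatticeReciprocity` (A-p03), which treats the `∏ 𝓞_{Kᵢ}`-module case (`Θ_v⁻¹(a·ẑ^{2g}) = ∏ 𝔞̂ᵢ`,
conclusions with ★ `ideleMulIdeal`); here the completed lattice is an arbitrary `Θ_v⁻¹(a·ẑ^{2g})` (CM by an ORDER of `F` allowed,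
[Deligne1971TravauxShimura] 4.18) and the conclusions are ∃-statements.  THEOREMS ONLY, over ★ R60-19 `latticeOfGL`
(`Λ_a = ℚⁿ ∩ a ẑⁿ`), ★ R60-14/14b (cyclic vector `v`, `Θ_v : ∏ᵢ 𝔸_{Kᵢ,f} ≅ 𝔸_{ℚ,f}^{2g}`) and ★ R60-35 §1
(`cmRepMatrix_algebraMap_mulVec_algebraMap`); no definition, no named fact, no instance, no `sorry` (D-0026, net Literature debt 0).

## The print

* [Milne2005ShimuraVarieties] §4 Prop. 4.18–4.19 pp. 48–49, §6 Thm. 6.11 p. 74 and p. 75: the marked variety of `[x, a]` has `H₁ = V ∩ a·Λ̂ = Λ_a`;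
  Def. 12.8 (60)–(62) p. 114: `σ[x, a] = [x, r_x(s)·a]`; §14 Cor. 14.11 p. 124: `H₁(A, ℚ) ≅ V` free of rank one over the CM algebra.
* [Shimura1998] §18.6 (Thm. 18.6 (1), pp. 124–125): `σA` is of type `(K, Φ; g(s)⁻¹𝔞)` — the lattice of the conjugate is the idèle
  `g(s)` (the reflex norm) applied to the lattice `𝔞`, `t𝔞 := K ∩ t·𝔞̂`.
* [Deligne1971TravauxShimura] 4.18–4.20 pp. 150–152: at the CM-algebra special pairs `V` is free of rank one over `L`, the
  reciprocity morphism is the reflex-norm tuple, and 4.19 (Shimura–Taniyama) is applied to the lattice `V_ℤ ∩ a·V_ẑ`.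

## What is proved (for `c : CMStructure g δ ι K`, a vector `v ∈ ℚ^{2g}`, `w = v ⊗ 1`, `Θ_v(u) = R(u)·w`)

* `act_apply_mem_latticeOfGL_iff` — **`q_v⁻¹(Λ_a) = F ∩ Θ_v⁻¹(a·ẑ^{2g})`**: `act(x)·v ∈ Λ_a ↔ ∃ y ∈ ẑ^{2g}, Θ_v(x ⊗ 1) = a·y`
  (★ `mem_latticeOfGL_iff_exists` + ★ `cmRepMatrix_algebraMap_mulVec_algebraMap`; no cyclicity needed).
* **`act_apply_mem_latticeOfGL_mul_iff`** — for a CYCLIC `v` (`x ↦ act(x)·v` bijective, ★ R60-14) and `r` with matrix `R(t₀)`: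
  `act(x)·v ∈ Λ_{r·a} ↔ ∃ u, Θ_v(u) ∈ a·ẑ^{2g} ∧ x ⊗ 1 = t₀·u` — **`q_v⁻¹(Λ_{r·a}) = F ∩ t₀·Θ_v⁻¹(a·ẑ^{2g})`**, i.e. the lattice
  of `[J, r·a]` is the idèle-tuple `t₀` applied to the completed lattice of `[J, a]` (surjectivity of `Θ_v` produces `u`, injectivity
  cancels it, ★ `cmRepMatrix_mul_mulVec` moves `R(t₀)` across).
* **`act_apply_mem_latticeOfGL_cmRecip_mul_iff`** — the (62) instance `R(t₀) = cmRecipMatrix c Φ E s`, `t₀ = (N_{E,Φᵢ}(s))ᵢ`: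
  «lattice of `[J, r(s)·a]` = `N_{E,Φ}(s) ·` completed lattice of `[J, a]`, intersected with `F`» — Shimura's `g(s)𝔞` clause of
  Thm. 18.6 (1) in the Siegel adelic coordinates (Milne's normalisation, as ★ `cmRecipMatrix`).

## References
* [Milne2005ShimuraVarieties] J. S. Milne, *Introduction to Shimura varieties* (2005), §4 Prop. 4.18–4.19 pp. 48–49, §6 Thm. 6.11 p. 74 and p. 75,
  Def. 12.8 (60)–(62) p. 114, §14 Cor. 14.11 p. 124 (pages of the 2017 revision).
* [Shimura1998] G. Shimura, *Abelian Varieties with Complex Multiplication and Modular Functions* (1998), §18.6 Thm. 18.6 (1), pp. 124–125.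
* [Deligne1971TravauxShimura] P. Deligne, *Travaux de Shimura*, Sém. Bourbaki 389 (1971), 4.18–4.20 pp. 150–152.
-/

noncomputable section

open Module Function NumberField Matrix IsDedekindDomain

namespace Literature.AlgebraicGeometry.ModuliOfAbelianVarieties

namespace CMStructure

open Literature.NumberTheory.ComplexMultiplication (reflexNormFiniteIdele)
open Literature.NumberTheory.Automorphic (integralFiniteAdeles)
open Literature.NumberTheory.Adeles (latticeOfGL mem_latticeOfGL_iff_exists)

variable {g : ℕ} {δ : Fin g → ℕ} {ι : Type} [Fintype ι] [DecidableEq ι] {K : ι → Type} [∀ i, Field (K i)]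
  [∀ i, NumberField (K i)] [∀ i, IsCMField (K i)] (c : CMStructure g δ ι K)

/-! ### §1. The lattice of `[J, a]` in `F`-coordinates -/

/-- **`q_v⁻¹(Λ_a) = F ∩ Θ_v⁻¹(a·ẑ^{2g})`** — for ANY `v ∈ ℚ^{2g}`: `act(x)·v ∈ Λ_a = ℚ^{2g} ∩ a·ẑ^{2g}` iff
`Θ_v(x ⊗ 1) = R(x ⊗ 1)·(v ⊗ 1)` lies in `a·ẑ^{2g}` (the rational element `x ⊗ 1 ∈ F ⊗ 𝔸_{ℚ,f}` acts by the base-changed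
matrix of `act x`, ★ `cmRepMatrix_algebraMap_mulVec_algebraMap`).  Milne: «`H₁` of the variety of `[x, a]` is `V ∩ a·Λ̂`».
[cite: Milne2005ShimuraVarieties, §4 Prop. 4.18–4.19 pp. 48–49, §6 Thm. 6.11 p. 74 and p. 75] [cite: Deligne1971TravauxShimura, 4.18–4.20 pp. 150–152] -/
theorem act_apply_mem_latticeOfGL_iff (v : Fin g ⊕ Fin g → ℚ) (a : GL (Fin g ⊕ Fin g) finAdeleQ) (x : Π i, K i) :
    c.act x v ∈ latticeOfGL a ↔
      ∃ y : Fin g ⊕ Fin g → finAdeleQ, (∀ j, y j ∈ integralFiniteAdeles ℚ) ∧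
        c.cmRepMatrix (fun i => algebraMap (K i) (FiniteAdeleRing (𝓞 (K i)) (K i)) (x i)) *ᵥ
            (fun j => algebraMap ℚ finAdeleQ (v j)) =
          (a : Matrix (Fin g ⊕ Fin g) (Fin g ⊕ Fin g) finAdeleQ) *ᵥ y := by
  rw [mem_latticeOfGL_iff_exists, c.cmRepMatrix_algebraMap_mulVec_algebraMap]

/-! ### §2. The lattice of `[J, r·a]`: multiply the completed lattice by the idèle tuple `t₀` with `R(t₀) = r` -/

/-- **THE CM LATTICE DICTIONARY — `q_v⁻¹(Λ_{r·a}) = F ∩ t₀·Θ_v⁻¹(a·ẑ^{2g})`**: for a CYCLIC vector `v` of the CM structure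
(`x ↦ act(x)·v : F ≅ ℚ^{2g}`, ★ R60-14) and `r ∈ GL_{2g}(𝔸_{ℚ,f})` whose matrix is `R(t₀)` (`t₀ ∈ ∏ᵢ 𝔸_{Kᵢ,f}` acting through
`act`, ★ `cmRepMatrix`), an element `x ∈ F` lands in the lattice `Λ_{r·a}` of the translated point `[J, r·a]` iff
`x ⊗ 1 = t₀ · u` for some `u` with `Θ_v(u) ∈ a·ẑ^{2g}` — the lattice of `[J, r·a]`, read in `F` through the cyclic vector, is the
idèle tuple `t₀` times the COMPLETED lattice `Θ_v⁻¹(a·ẑ^{2g})` of `[J, a]`, intersected with `F` (Shimura's `t𝔞 = K ∩ t·𝔞̂`;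
`Θ_v` is a bijection `∏ᵢ 𝔸_{Kᵢ,f} ≅ 𝔸_{ℚ,f}^{2g}` by ★ `bijective_cmRepMatrix_mulVec_of_bijective_act`, equivariant by
★ `cmRepMatrix_mul_mulVec`). [cite: Shimura1998, §18.6 Thm. 18.6 (1) pp. 124–125] [cite: Milne2005ShimuraVarieties, §4 Prop. 4.18–4.19 pp. 48–49, §6 p. 75, Def. 12.8 (60)–(62) p. 114]
[cite: Deligne1971TravauxShimura, 4.18–4.20 pp. 150–152] -/
theorem act_apply_mem_latticeOfGL_mul_iff {v : Fin g ⊕ Fin g → ℚ} (hv : Bijective fun x : Π i, K i => c.act x v)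
    {t₀ : Π i, FiniteAdeleRing (𝓞 (K i)) (K i)} {r : GL (Fin g ⊕ Fin g) finAdeleQ}
    (hr : (r : Matrix (Fin g ⊕ Fin g) (Fin g ⊕ Fin g) finAdeleQ) = c.cmRepMatrix t₀)
    (a : GL (Fin g ⊕ Fin g) finAdeleQ) (x : Π i, K i) :
    c.act x v ∈ latticeOfGL (r * a) ↔
      ∃ u : Π i, FiniteAdeleRing (𝓞 (K i)) (K i),
        (∃ y : Fin g ⊕ Fin g → finAdeleQ, (∀ j, y j ∈ integralFiniteAdeles ℚ) ∧
          c.cmRepMatrix u *ᵥ (fun j => algebraMap ℚ finAdeleQ (v j)) =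
            (a : Matrix (Fin g ⊕ Fin g) (Fin g ⊕ Fin g) finAdeleQ) *ᵥ y) ∧
        (fun i => algebraMap (K i) (FiniteAdeleRing (𝓞 (K i)) (K i)) (x i)) = t₀ * u := by
  have hΘ := c.bijective_cmRepMatrix_mulVec_of_bijective_act hv
  rw [c.act_apply_mem_latticeOfGL_iff v (r * a) x]
  constructor
  · rintro ⟨y, hy, hxy⟩
    obtain ⟨u, hu⟩ := hΘ.2 ((a : Matrix (Fin g ⊕ Fin g) (Fin g ⊕ Fin g) finAdeleQ) *ᵥ y)
    refine ⟨u, ⟨y, hy, hu⟩, hΘ.1 ?_⟩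
    change c.cmRepMatrix _ *ᵥ _ = c.cmRepMatrix (t₀ * u) *ᵥ _
    rw [hxy, c.cmRepMatrix_mul_mulVec]
    change _ = c.cmRepMatrix t₀ *ᵥ ((fun t => c.cmRepMatrix t *ᵥ fun j => algebraMap ℚ finAdeleQ (v j)) u)
    rw [hu, Matrix.mulVec_mulVec, ← hr, Units.val_mul]
  · rintro ⟨u, ⟨y, hy, hu⟩, hxu⟩
    refine ⟨y, hy, ?_⟩
    rw [hxu, c.cmRepMatrix_mul_mulVec, hu, Matrix.mulVec_mulVec, ← hr, Units.val_mul]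

/-- Set form of the dictionary: the pull-back of `Λ_{r·a}` along the cyclic vector is `{x ∈ F | x ⊗ 1 ∈ t₀ · Θ_v⁻¹(a·ẑ^{2g})}`.
[cite: Shimura1998, §18.6 Thm. 18.6 (1) pp. 124–125] [cite: Milne2005ShimuraVarieties, §4 Prop. 4.18–4.19 pp. 48–49, §6 p. 75, Def. 12.8 (60)–(62) p. 114] -/
theorem preimage_act_apply_latticeOfGL_mul {v : Fin g ⊕ Fin g → ℚ} (hv : Bijective fun x : Π i, K i => c.act x v)
    {t₀ : Π i, FiniteAdeleRing (𝓞 (K i)) (K i)} {r : GL (Fin g ⊕ Fin g) finAdeleQ}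
    (hr : (r : Matrix (Fin g ⊕ Fin g) (Fin g ⊕ Fin g) finAdeleQ) = c.cmRepMatrix t₀)
    (a : GL (Fin g ⊕ Fin g) finAdeleQ) :
    (fun x : Π i, K i => c.act x v) ⁻¹' (latticeOfGL (r * a) : Set (Fin g ⊕ Fin g → ℚ)) =
      {x | ∃ u : Π i, FiniteAdeleRing (𝓞 (K i)) (K i),
        c.cmRepMatrix u *ᵥ (fun j => algebraMap ℚ finAdeleQ (v j)) ∈
            (fun y => (a : Matrix (Fin g ⊕ Fin g) (Fin g ⊕ Fin g) finAdeleQ) *ᵥ y) ''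
              {y | ∀ j, y j ∈ integralFiniteAdeles ℚ} ∧
          (fun i => algebraMap (K i) (FiniteAdeleRing (𝓞 (K i)) (K i)) (x i)) = t₀ * u} := by
  ext x
  rw [Set.mem_preimage, SetLike.mem_coe, c.act_apply_mem_latticeOfGL_mul_iff hv hr a x, Set.mem_setOf_eq]
  refine exists_congr fun u => and_congr_left fun _ => ?_
  constructor
  · rintro ⟨y, hy, hu⟩
    exact ⟨y, hy, hu.symm⟩
  · rintro ⟨y, hy, hu⟩
    exact ⟨y, hy, hu.symm⟩

/-! ### §3. The (62) instance: `r = r(s)`, `t₀ = (N_{E,Φᵢ}(s))ᵢ` -/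

/-- **THE RECIPROCITY INSTANCE — the lattice of `σ[J, a] = [J, r(s)·a]` is `N_{E,Φ}(s) ·` the completed lattice of `[J, a]`**:
for `r ∈ GL_{2g}(𝔸_{ℚ,f})` with matrix the reciprocity element `cmRecipMatrix c Φ E s = R((N_{E,Φᵢ}(s))ᵢ)` (the binding of
`SiegelRationalModel.IsCanonical`), `act(x)·v ∈ Λ_{r·a} ↔ ∃ u, Θ_v(u) ∈ a·ẑ^{2g} ∧ x ⊗ 1 = (N_{E,Φᵢ}(s))ᵢ · u` — Shimura's
«`σA` is of type `(K, Φ; g(s)𝔞)`» clause (Thm. 18.6 (1)) in the Siegel adelic coordinates, Milne's normalisation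
(★ `cmRecipMatrix` docstring: [Deligne1971TravauxShimura] 3.9.1 prints the inverse). [cite: Shimura1998, §18.6 Thm. 18.6 (1) pp. 124–125]
[cite: Milne2005ShimuraVarieties, Def. 12.8 (60)–(62) p. 114; §14 Cor. 14.11 p. 124] [cite: Deligne1971TravauxShimura, 4.18–4.20 pp. 150–152] -/
theorem act_apply_mem_latticeOfGL_cmRecip_mul_iff {v : Fin g ⊕ Fin g → ℚ}
    (hv : Bijective fun x : Π i, K i => c.act x v) (Φ : ∀ i, Literature.AlgebraicGeometry.Motives.CMType (K i))
    (E : IntermediateField ℚ ℂ) [NumberField ↥E] (s : (FiniteAdeleRing (𝓞 ↥E) ↥E)ˣ)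
    {r : GL (Fin g ⊕ Fin g) finAdeleQ}
    (hr : (r : Matrix (Fin g ⊕ Fin g) (Fin g ⊕ Fin g) finAdeleQ) = c.cmRecipMatrix Φ E s)
    (a : GL (Fin g ⊕ Fin g) finAdeleQ) (x : Π i, K i) :
    c.act x v ∈ latticeOfGL (r * a) ↔
      ∃ u : Π i, FiniteAdeleRing (𝓞 (K i)) (K i),
        (∃ y : Fin g ⊕ Fin g → finAdeleQ, (∀ j, y j ∈ integralFiniteAdeles ℚ) ∧
          c.cmRepMatrix u *ᵥ (fun j => algebraMap ℚ finAdeleQ (v j)) =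
            (a : Matrix (Fin g ⊕ Fin g) (Fin g ⊕ Fin g) finAdeleQ) *ᵥ y) ∧
        (fun i => algebraMap (K i) (FiniteAdeleRing (𝓞 (K i)) (K i)) (x i)) =
          (fun i => ((reflexNormFiniteIdele (K i) (Φ i) E s : (FiniteAdeleRing (𝓞 (K i)) (K i))ˣ) :
            FiniteAdeleRing (𝓞 (K i)) (K i))) * u :=
  c.act_apply_mem_latticeOfGL_mul_iff hv (t₀ := fun i =>
    ((reflexNormFiniteIdele (K i) (Φ i) E s : (FiniteAdeleRing (𝓞 (K i)) (K i))ˣ) : FiniteAdeleRing (𝓞 (K i)) (K i)))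
    (by rw [hr]; rfl) a x

end CMStructure

end Literature.AlgebraicGeometry.ModuliOfAbelianVarieties

end
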